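import Summits.AtomisticToContinuum.HydrodynamicLimit.Theorems.StiffCollisionalRelaxationAprioriBoundsCeilingStatics
import Summits.AtomisticToContinuum.HydrodynamicLimit.Theorems.StiffCollisionalRelaxationAprioriBoundsFloorStaticsLayer
import Literature.Analysis.FluidPDE.HardSphereTorusMeasure
import Mathlib.MeasureTheory.Measure.Lebesgue.VolumeOfBalls
import Mathlib.Analysis.Complex.ExponentialBounds
import HarnessLib

/-!
# Floor statics: the lower-tail occupation bound for the canonical hard-sphere gas

Supporting file of the line `Sketch` for the crux `AprioriBounds` (stmt-AtomisticToContinuum-14827;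
`Summit.AtomisticToContinuum.HydrodynamicLimit.Theses.StiffCollisionalRelaxation.AprioriBounds`), lead
prover `prover-line-stmt-AtomisticToContinuum-14827-c2-0`.  It serves the registered stub `stub_floorFixed`
(the fixed-`(s, x)` mesoscopic FLOOR bound of component (ii) of the crux, "no mesoscopic cell is ever
empty") by delivering the STATIC INPUT `H-low` of its equilibrium rung, consumed verbatim as the hypothesis
`hstat` of `floorFixed_homogeneous_of_static`: for the canonical gas `P = posGibbsMeasure 1 ε_N (N+1)` of
`N + 1` hard spheres of diameter `ε_N = hsDiameter σ N` on `𝕋³` at small reduced density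
(`SmallDensity uniformProfile σ`, `σ ≤ 1/10`) and every minimal-image ball `A = B(c, r)`, `2ε_N ≤ r < 1/4`,
with mean occupation number `λ = (N+1)·(4/3)πr³`,

  `P{#A ≤ λ/16} ≤ 8 · exp(−(log 2/16) λ)`        (`posGibbs_ballCount_le_le`;
  quantifier form `floor_statics_hLow`, the sub-goal registered on the crux item for this file).

Proof (`posGibbs_ballCount_le_le_of_layer`, from the layer inequality `floorStat_layer_ineq` of the sibling
file, taken there as the hypothesis `hKI`).  Put `A⁺ = B(c, r + ε_N)`, `M = 8(N+1)·vol A⁺`,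
`p_j = P{#A = j}`, `q_j = P{#A = j, #A⁺ ≤ M}`, `e = P{#A⁺ > M}`.
* TAIL: `e ≤ exp(−(N+1) vol A⁺ (16 log 2 − 6)) ≤ exp(−(log 2/8) λ)` — the Ruelle-factor Chernoff bound
  `posGibbs_sum_gt_le` (`g = 𝟙_{A⁺}`, `L = 1`, `K = 8`).
* EXCLUDED VOLUME (`floorTail_excluded_small`): `M · vol B(·, ε_N) = 8 vol A⁺ · (4/3)πσ³ ≤ vol A / 4`
  (`(N+1)ε_N³ = σ³`, `vol A⁺ ≤ (27/8) vol A`, `σ³ ≤ 10⁻³`, `π < 4`).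
* LAYER STEP (`floorTail_layer_step`): `hKI` reads `a((N+1) − j) q_j ≤ (j+1) p_{j+1}` with `a ≥ (3/4) vol A`;
  for `j + 1 ≤ 3λ/16`, `a((N+1) − j) ≥ (39/64)λ ≥ 2(j+1)`, so `q_j ≤ p_{j+1}/2` and, with the union bound
  `p_j ≤ q_j + e` (`floorTail_layer_split`), `p_j ≤ p_{j+1}/2 + e`.
* ITERATION (`floorTail_geom_induction`, `floorTail_layer_small`): from `k = ⌊3λ/16⌋₊` down,
  `p_{k−m} ≤ 2^{−m} + 2e`; for `j ≤ λ/16`, `m = k − j ≥ λ/8 − 1`, so `p_j ≤ 4 exp(−(log 2/8) λ)`.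
* SUM (`floorTail_sum_layers`, `floorTail_final_numeric`): `#A ∈ ℕ`, so
  `P{#A ≤ λ/16} ≤ ∑_{j ≤ ⌊λ/16⌋₊} p_j ≤ (λ/16 + 1) · 4 exp(−(log 2/8) λ) ≤ 8 exp(−(log 2/16) λ)`
  (`u + 1 ≤ 2·2^u`).  (If `8 exp(−(log 2/16) λ) ≥ 1` the claim is trivial; otherwise `λ > 48`.)
No new definitions, no named facts; axioms `propext`, `Classical.choice`, `Quot.sound`.
-/

noncomputable section

namespace Summit.AtomisticToContinuum.HydrodynamicLimit.Theorems.AdiabatCeiling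

open MeasureTheory Finset Filter Set Literature.MathematicalPhysics.KineticTheory Literature.Analysis.FluidPDE
open scoped ENNReal

/-- **Geometric induction down the layers.**  If `p k ≤ 1`, `0 ≤ e` and `p j ≤ p (j+1) / 2 + e` for all
`j < k`, then `p (k − m) ≤ 2^{−m} + 2e` for all `m ≤ k`. -/
theorem floorTail_geom_induction {p : ℕ → ℝ} {e : ℝ} {k : ℕ} (he : 0 ≤ e) (hpk : p k ≤ 1)
    (hstep : ∀ j < k, p j ≤ p (j + 1) / 2 + e) :
    ∀ m ≤ k, p (k - m) ≤ (1 / 2) ^ m + 2 * e := by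
  intro m
  induction m with
  | zero => intro; rw [Nat.sub_zero, pow_zero]; linarith
  | succ m ih =>
    intro hm
    have h1 := ih (Nat.le_of_succ_le hm)
    have h2 := hstep (k - (m + 1)) (by omega)
    rw [show k - (m + 1) + 1 = k - m by omega] at h2
    rw [pow_succ]
    linarith

/-- **The small layers are exponentially improbable.**  If `p ≤ 1`, `0 ≤ e ≤ exp(−(log 2/8) Λ)`, `Λ > 8` and
`p j ≤ p (j+1)/2 + e` whenever `j + 1 ≤ 3Λ/16`, then `p j ≤ 4 exp(−(log 2/8) Λ)` for every `j ≤ Λ/16`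
(iterate from `k = ⌊3Λ/16⌋₊` down to `j`: `k − j ≥ Λ/8 − 1` halvings). -/
theorem floorTail_layer_small {p : ℕ → ℝ} {e Λ : ℝ} (he : 0 ≤ e) (hp1 : ∀ j, p j ≤ 1)
    (hstep : ∀ j : ℕ, (j : ℝ) + 1 ≤ 3 * Λ / 16 → p j ≤ p (j + 1) / 2 + e)
    (heΛ : e ≤ Real.exp (-(Real.log 2 / 8 * Λ))) (hΛ : 8 < Λ) {j : ℕ} (hj : (j : ℝ) ≤ Λ / 16) :
    p j ≤ 4 * Real.exp (-(Real.log 2 / 8 * Λ)) := by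
  obtain ⟨k, hk⟩ : ∃ k : ℕ, k = ⌊3 * Λ / 16⌋₊ := ⟨_, rfl⟩
  have hk1 : (k : ℝ) ≤ 3 * Λ / 16 := hk ▸ Nat.floor_le (by linarith)
  have hk2 : 3 * Λ / 16 < (k : ℝ) + 1 := hk ▸ Nat.lt_floor_add_one _
  have hjk : j ≤ k := by
    have h : (j : ℝ) < (k : ℝ) + 1 := by linarith
    exact Nat.lt_succ_iff.1 (by exact_mod_cast h)
  have hind := floorTail_geom_induction he (hp1 k) (fun i hi => hstep i (by
      have h : (i : ℝ) + 1 ≤ (k : ℝ) := by exact_mod_cast hi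
      linarith)) (k - j) (Nat.sub_le k j)
  rw [Nat.sub_sub_self hjk] at hind
  have hm : Λ / 8 - 1 ≤ ((k - j : ℕ) : ℝ) := by
    rw [Nat.cast_sub hjk]
    linarith
  have hl2 : 0 ≤ Real.log 2 := Real.log_nonneg one_le_two
  have hhalf : (1 / 2 : ℝ) ^ (k - j) ≤ 2 * Real.exp (-(Real.log 2 / 8 * Λ)) := by
    rw [show (1 / 2 : ℝ) ^ (k - j) = Real.exp (-(((k - j : ℕ) : ℝ) * Real.log 2)) by
      rw [Real.exp_neg, Real.exp_nat_mul, Real.exp_log two_pos, one_div, inv_pow]]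
    have hmul := mul_le_mul_of_nonneg_left hm hl2
    calc Real.exp (-(((k - j : ℕ) : ℝ) * Real.log 2))
        ≤ Real.exp (Real.log 2 + -(Real.log 2 / 8 * Λ)) := Real.exp_le_exp.2 (by linarith)
      _ = 2 * Real.exp (-(Real.log 2 / 8 * Λ)) := by rw [Real.exp_add, Real.exp_log two_pos]
  linarith

/-- **Summing the small layers**: `(⌊Λ/16⌋₊ + 1) · 4 exp(−(log 2/8) Λ) ≤ 8 exp(−(log 2/16) Λ)` for `Λ ≥ 0`
(`u + 1 ≤ 2 · 2^u` for `u = Λ/16 ≥ 0`). -/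
theorem floorTail_final_numeric {Λ : ℝ} (hΛ : 0 ≤ Λ) :
    ((⌊Λ / 16⌋₊ : ℝ) + 1) * (4 * Real.exp (-(Real.log 2 / 8 * Λ))) ≤
      8 * Real.exp (-(Real.log 2 / 16 * Λ)) := by
  have hfl : (⌊Λ / 16⌋₊ : ℝ) ≤ Λ / 16 := Nat.floor_le (by positivity)
  have hl2 : (1 : ℝ) / 2 < Real.log 2 := by
    have := Real.log_two_gt_d9
    linarith
  obtain ⟨u, hu⟩ : ∃ u : ℝ, u = Λ / 16 := ⟨_, rfl⟩
  have hu0 : 0 ≤ u := by rw [hu]; positivity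
  have hexp : Real.exp (-(Real.log 2 / 8 * Λ)) =
      Real.exp (-(u * Real.log 2)) * Real.exp (-(Real.log 2 / 16 * Λ)) := by
    rw [← Real.exp_add, hu]
    congr 1
    ring
  have h1 : u * Real.log 2 + 1 ≤ Real.exp (u * Real.log 2) := Real.add_one_le_exp _
  have h2a := mul_le_mul_of_nonneg_left hl2.le hu0
  have h2 : u + 1 ≤ 2 * Real.exp (u * Real.log 2) := by linarith
  have h3 : (u + 1) * Real.exp (-(u * Real.log 2)) ≤ 2 := by
    rw [Real.exp_neg, ← div_eq_mul_inv, div_le_iff₀ (Real.exp_pos _)]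
    exact h2
  rw [hexp, ← hu]
  calc ((⌊u⌋₊ : ℝ) + 1) * (4 * (Real.exp (-(u * Real.log 2)) * Real.exp (-(Real.log 2 / 16 * Λ))))
      ≤ (u + 1) * (4 * (Real.exp (-(u * Real.log 2)) * Real.exp (-(Real.log 2 / 16 * Λ)))) := by
        rw [hu]
        gcongr
    _ = 4 * ((u + 1) * Real.exp (-(u * Real.log 2))) * Real.exp (-(Real.log 2 / 16 * Λ)) := by ring
    _ ≤ 4 * 2 * Real.exp (-(Real.log 2 / 16 * Λ)) := by gcongr
    _ = 8 * Real.exp (-(Real.log 2 / 16 * Λ)) := by norm_num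

/-- **The layer step from the layer inequality.**  Abstract form: if `a (n − j) q_j ≤ (j+1) p_{j+1}`,
`p_j ≤ q_j + e`, `q_j ≥ 0`, with `a ≥ 3V/4`, `0 ≤ V ≤ 1`, `0 ≤ n`, then for `j + 1 ≤ 3 n V/16`,
`p_j ≤ p_{j+1}/2 + e` (`a (n − j) ≥ (3V/4)(13n/16) = 39 nV/64 ≥ 2(j+1)`). -/
theorem floorTail_layer_step {p q : ℕ → ℝ} {a V n e : ℝ} (hq0 : ∀ j, 0 ≤ q j)
    (hpq : ∀ j, p j ≤ q j + e)
    (hKI : ∀ j : ℕ, a * (n - j) * q j ≤ ((j : ℝ) + 1) * p (j + 1))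
    (hV0 : 0 ≤ V) (hV1 : V ≤ 1) (hn : 0 ≤ n) (ha : 3 / 4 * V ≤ a) (j : ℕ)
    (hj : (j : ℝ) + 1 ≤ 3 * (n * V) / 16) : p j ≤ p (j + 1) / 2 + e := by
  have hnV : n * V ≤ n := mul_le_of_le_one_right hn hV1
  have hnV0 : 0 ≤ n * V := mul_nonneg hn hV0
  have hnj : 13 * n / 16 ≤ n - j := by linarith
  have ha0 : 0 ≤ a := le_trans (by positivity) ha
  have hprod : 3 / 4 * V * (13 * n / 16) ≤ a * (n - j) := mul_le_mul ha hnj (by positivity) ha0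
  have h2 : 2 * ((j : ℝ) + 1) ≤ a * (n - j) := by linarith
  have h3 : ((j : ℝ) + 1) * (2 * q j) ≤ ((j : ℝ) + 1) * p (j + 1) := by
    calc ((j : ℝ) + 1) * (2 * q j) = 2 * ((j : ℝ) + 1) * q j := by ring
      _ ≤ a * (n - j) * q j := mul_le_mul_of_nonneg_right h2 (hq0 j)
      _ ≤ ((j : ℝ) + 1) * p (j + 1) := hKI j
  have h4 : 2 * q j ≤ p (j + 1) := le_of_mul_le_mul_left h3 (by positivity)
  linarith [hpq j]

/-- **Volume of a small minimal-image ball of `𝕋³`**: `vol B(c, ρ) = (4/3) π ρ³` for `0 ≤ ρ < 1/2`. -/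
theorem floorTail_volumeReal_ball {ρ : ℝ} (hρ0 : 0 ≤ ρ) (hρ : ρ < 1 / 2) (c : T3) :
    volume.real {y : T3 | Torus.euclidDist y c < ρ} = 4 / 3 * Real.pi * ρ ^ 3 := by
  rw [measureReal_def, Torus.volume_euclidDist_lt hρ c, EuclideanSpace.volume_ball_fin_three,
    ENNReal.toReal_mul, ENNReal.toReal_pow, ENNReal.toReal_ofReal hρ0,
    ENNReal.toReal_ofReal (by positivity)]
  ring

/-- **The excluded volume is small**: for `0 < ε`, `2ε ≤ r`, `0 < σ ≤ 1/10`,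
`8 · (4/3)π(r+ε)³ · (4/3)πσ³ ≤ (1/4) · (4/3)πr³` (as `(r+ε)³ ≤ (27/8) r³`, `σ³ ≤ 10⁻³`, `π < 4`). -/
theorem floorTail_excluded_small {r ε σ : ℝ} (hε : 0 < ε) (h2ε : 2 * ε ≤ r) (hσ : 0 < σ)
    (hσ10 : σ ≤ 1 / 10) :
    8 * (4 / 3 * Real.pi * (r + ε) ^ 3) * (4 / 3 * Real.pi * σ ^ 3) ≤
      1 / 4 * (4 / 3 * Real.pi * r ^ 3) := by
  have hr0 : 0 < r := by linarith
  have hre : r + ε ≤ 3 / 2 * r := by linarith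
  have hre3 : (r + ε) ^ 3 ≤ 27 / 8 * r ^ 3 := by
    calc (r + ε) ^ 3 ≤ (3 / 2 * r) ^ 3 := pow_le_pow_left₀ (by linarith) hre 3
      _ = 27 / 8 * r ^ 3 := by ring
  have hσ3 : σ ^ 3 ≤ 1 / 1000 := by
    calc σ ^ 3 ≤ (1 / 10) ^ 3 := pow_le_pow_left₀ hσ.le hσ10 3
      _ = 1 / 1000 := by norm_num
  have hπ := Real.pi_pos
  have hπ4 := Real.pi_lt_four
  have hr3 := pow_pos hr0 3
  calc 8 * (4 / 3 * Real.pi * (r + ε) ^ 3) * (4 / 3 * Real.pi * σ ^ 3)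
      ≤ 8 * (4 / 3 * Real.pi * (27 / 8 * r ^ 3)) * (4 / 3 * Real.pi * (1 / 1000)) := by gcongr
    _ = 6 / 125 * (Real.pi * r ^ 3) * Real.pi := by ring
    _ ≤ 6 / 125 * (Real.pi * r ^ 3) * 4 := by gcongr
    _ ≤ 1 / 4 * (4 / 3 * Real.pi * r ^ 3) := by nlinarith [mul_pos hπ hr3]

/-- Occupation numbers are natural numbers: `∑ᵢ 𝟙_A(xᵢ) = #{i | xᵢ ∈ A}`. -/
theorem floorTail_sum_indicator_natCast {n : ℕ} (A : Set T3) (x : Fin n → T3) :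
    ∃ m : ℕ, (∑ i, A.indicator (fun _ => (1 : ℝ)) (x i)) = m := by
  classical
  refine ⟨(univ.filter fun i => x i ∈ A).card, ?_⟩
  rw [Finset.natCast_card_filter]
  refine Finset.sum_congr rfl fun i _ => ?_
  by_cases h : x i ∈ A
  · rw [Set.indicator_of_mem h, if_pos h]
  · rw [Set.indicator_of_notMem h, if_neg h]


/-- **Union bound per layer**: `P{#A = t} ≤ P{#A = t, #A⁺ ≤ M} + P{M < #A⁺}`. -/
theorem floorTail_layer_split {n : ℕ} (P : Measure (Fin n → T3)) [IsFiniteMeasure P] (A Ap : Set T3)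
    (M t : ℝ) :
    P.real {x | (∑ i, A.indicator (fun _ => (1 : ℝ)) (x i)) = t} ≤
      P.real {x | (∑ i, A.indicator (fun _ => (1 : ℝ)) (x i)) = t ∧
          (∑ i, Ap.indicator (fun _ => (1 : ℝ)) (x i)) ≤ M} +
        P.real {x | M < ∑ i, Ap.indicator (fun _ => (1 : ℝ)) (x i)} := by
  refine (measureReal_mono (fun x hx => ?_) (measure_ne_top _ _)).trans (measureReal_union_le _ _)
  by_cases h : (∑ i, Ap.indicator (fun _ => (1 : ℝ)) (x i)) ≤ M
  · exact Or.inl ⟨hx, h⟩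
  · exact Or.inr (not_le.1 h)

/-- **Summing over the small layers**: `P{#A ≤ t} ≤ ∑_{j ≤ ⌊t⌋₊} P{#A = j}` (`#A` is a natural number). -/
theorem floorTail_sum_layers {n : ℕ} (P : Measure (Fin n → T3)) [IsFiniteMeasure P] (A : Set T3)
    (t : ℝ) :
    P.real {x | (∑ i, A.indicator (fun _ => (1 : ℝ)) (x i)) ≤ t} ≤
      ∑ j ∈ Finset.range (⌊t⌋₊ + 1),
        P.real {x | (∑ i, A.indicator (fun _ => (1 : ℝ)) (x i)) = (j : ℝ)} := by
  refine (measureReal_mono (fun x hx => ?_) (measure_ne_top _ _)).trans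
    (measureReal_biUnion_finset_le _ _)
  obtain ⟨m, hm⟩ := floorTail_sum_indicator_natCast A x
  rw [Set.mem_setOf_eq, hm] at hx
  exact Set.mem_iUnion₂.2 ⟨m, Finset.mem_range.2 (Nat.lt_succ_of_le (Nat.le_floor hx)), hm⟩

/-- **Floor statics from the layer inequality** (interface `H-low` of the lead's wave, with the layer
inequality `hKI` of the sibling file as a hypothesis).  For the canonical gas `P = posGibbsMeasure 1 ε_N (N+1)`
at small reduced density `σ ≤ 1/10` and a ball `A = B(c, r)` with `2ε_N ≤ r < 1/4`, writing
`λ = (N+1)·(4/3)πr³` for the mean occupation number of `A`: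
`P{#A ≤ λ/16} ≤ 8 exp(−(log 2/16) λ)`.
Proof: with `M = 8(N+1) vol A⁺`, the Chernoff tail `e = P{#A⁺ > M} ≤ exp(−5λ)` (`posGibbs_sum_gt_le`,
`K = 8`); the excluded volume `M v ≤ vol A/4` (`σ ≤ 1/10`); hence by `hKI` every layer `j + 1 ≤ 3λ/16` has
`P{#A = j} ≤ P{#A = j+1}/2 + e`; iterating down from `⌊3λ/16⌋₊`, `P{#A = j} ≤ 4 exp(−(log 2/8)λ)` for
`j ≤ λ/16`, and summing these `⌊λ/16⌋₊ + 1` layers gives the claim. -/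
theorem posGibbs_ballCount_le_le_of_layer {σ : ℝ} (hS : SmallDensity uniformProfile σ)
    (hσ10 : σ ≤ 1 / 10)
    (hKI : ∀ (N : ℕ) (c : T3) (r M : ℝ), 0 ≤ M → ∀ (j : ℕ),
      (volume.real {y : T3 | Torus.euclidDist y c < r} -
            M * volume.real {y : T3 | Torus.euclidDist y c < hsDiameter σ N}) *
          (((N : ℝ) + 1) - j) *
          (posGibbsMeasure (fun _ => (1 : ℝ)) (hsDiameter σ N) (N + 1)).real
            {x | (∑ i, ({y : T3 | Torus.euclidDist y c < r}).indicator (fun _ => (1 : ℝ)) (x i)) = j ∧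
              (∑ i, ({y : T3 | Torus.euclidDist y c < r + hsDiameter σ N}).indicator
                  (fun _ => (1 : ℝ)) (x i)) ≤ M} ≤
        ((j : ℝ) + 1) *
          (posGibbsMeasure (fun _ => (1 : ℝ)) (hsDiameter σ N) (N + 1)).real
            {x | (∑ i, ({y : T3 | Torus.euclidDist y c < r}).indicator (fun _ => (1 : ℝ)) (x i)) =
              (j : ℝ) + 1})
    (N : ℕ) (c : T3) (r : ℝ) (h2ε : 2 * hsDiameter σ N ≤ r) (hr : r < 1 / 4) :
    posGibbsMeasure (fun _ => (1 : ℝ)) (hsDiameter σ N) (N + 1)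
        {x | (∑ i, ({y : T3 | Torus.euclidDist y c < r}).indicator (fun _ => (1 : ℝ)) (x i)) ≤
            ((N : ℝ) + 1) * (4 / 3 * Real.pi * r ^ 3) / 16} ≤
      ENNReal.ofReal (8 * Real.exp (-(Real.log 2 / 16 * (((N : ℝ) + 1) * (4 / 3 * Real.pi * r ^ 3))))) := by
  classical
  have hσ := hS.σ_pos
  have hε := hsDiameter_pos hσ N
  have hr0 : 0 < r := by linarith
  haveI hprob : IsProbabilityMeasure (posGibbsMeasure (fun _ => (1 : ℝ)) (hsDiameter σ N) (N + 1)) :=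
    isProbabilityMeasure_posGibbsMeasure (a₀ := fun _ : T3 => (1 : ℝ)) continuous_const (fun _ => one_pos)
      hS.σ_lt_half.le N
  -- the trivial case: the bound is at least one
  by_cases htriv : 1 ≤ 8 * Real.exp (-(Real.log 2 / 16 * (((N : ℝ) + 1) * (4 / 3 * Real.pi * r ^ 3))))
  · exact prob_le_one.trans (by rw [← ENNReal.ofReal_one]; exact ENNReal.ofReal_le_ofReal htriv)
  push Not at htriv
  -- names: the gas, the ball, its enlargement, the mean occupation number
  set P := posGibbsMeasure (fun _ => (1 : ℝ)) (hsDiameter σ N) (N + 1)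
  set A : Set T3 := {y : T3 | Torus.euclidDist y c < r}
  set Ap : Set T3 := {y : T3 | Torus.euclidDist y c < r + hsDiameter σ N}
  set Λ : ℝ := ((N : ℝ) + 1) * (4 / 3 * Real.pi * r ^ 3) with hΛ
  -- `λ > 48`, else the bound is trivial
  have hl2 := Real.log_two_gt_d9
  have hΛ48 : 48 < Λ := by
    by_contra h
    push Not at h
    have h1 : Real.exp (-(Real.log 2 / 16 * 48)) ≤ Real.exp (-(Real.log 2 / 16 * Λ)) :=
      Real.exp_le_exp.2 (neg_le_neg (mul_le_mul_of_nonneg_left h (by positivity)))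
    have h8 : Real.exp (-(Real.log 2 / 16 * 48)) = 1 / 8 := by
      rw [show -(Real.log 2 / 16 * 48) = -(((3 : ℕ) : ℝ) * Real.log 2) by push_cast; ring, Real.exp_neg,
        Real.exp_nat_mul, Real.exp_log two_pos]
      norm_num
    linarith
  have hΛ0 : 0 ≤ Λ := by linarith
  -- volumes
  have hV : volume.real A = 4 / 3 * Real.pi * r ^ 3 := floorTail_volumeReal_ball hr0.le (by linarith) c
  have hVp : volume.real Ap = 4 / 3 * Real.pi * (r + hsDiameter σ N) ^ 3 :=
    floorTail_volumeReal_ball (by linarith) (by linarith) c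
  have hv : volume.real {y : T3 | Torus.euclidDist y c < hsDiameter σ N} =
      4 / 3 * Real.pi * hsDiameter σ N ^ 3 := floorTail_volumeReal_ball hε.le (by linarith) c
  have hnε : ((N : ℝ) + 1) * hsDiameter σ N ^ 3 = σ ^ 3 := by
    have h := succ_mul_hsDiameter_pow_three σ N
    push_cast at h
    exact h
  have hV1 : 4 / 3 * Real.pi * r ^ 3 ≤ 1 := by
    have hr3 : r ^ 3 < (1 / 4) ^ 3 := pow_lt_pow_left₀ hr hr0.le three_ne_zero
    have h1 : Real.pi * r ^ 3 ≤ 4 * r ^ 3 := mul_le_mul_of_nonneg_right Real.pi_lt_four.le (pow_nonneg hr0.le 3)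
    linarith
  -- the Chernoff tail of `#A⁺` (ceiling statics, `K = 8`)
  have hApm : MeasurableSet Ap :=
    measurableSet_lt (Torus.continuous_euclidDist.comp (continuous_id.prodMk continuous_const)).measurable
      measurable_const
  have hint : ∫ y, Ap.indicator (fun _ => (1 : ℝ)) y = volume.real Ap := by
    rw [integral_indicator hApm, setIntegral_const, smul_eq_mul, mul_one]
  obtain ⟨M, hM⟩ : ∃ M : ℝ, M = ((N : ℝ) + 1) * 8 * volume.real Ap := ⟨_, rfl⟩
  have hM0 : 0 ≤ M := by rw [hM]; exact mul_nonneg (by positivity) measureReal_nonneg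
  have htail : P {x | M < ∑ i, Ap.indicator (fun _ => (1 : ℝ)) (x i)} ≤
      ENNReal.ofReal (Real.exp (-(((N : ℝ) + 1) * volume.real Ap / 1 *
        (8 * Real.log (8 / 2) - 8 + 2)))) := by
    have h := posGibbs_sum_gt_le hS N (g := Ap.indicator fun _ => (1 : ℝ)) (measurable_const.indicator hApm)
      one_pos (fun y => Set.indicator_nonneg (fun _ _ => zero_le_one) y)
      (fun y => Set.indicator_apply_le' (fun _ => le_rfl) fun _ => zero_le_one) (K := 8) (by norm_num)
    rw [hint, ← hM] at h
    exact h
  obtain ⟨e, he⟩ : ∃ e : ℝ, e = P.real {x | M < ∑ i, Ap.indicator (fun _ => (1 : ℝ)) (x i)} := ⟨_, rfl⟩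
  have he0 : 0 ≤ e := he ▸ measureReal_nonneg
  have heΛ : e ≤ Real.exp (-(Real.log 2 / 8 * Λ)) := by
    rw [he, measureReal_def]
    refine (ENNReal.toReal_le_of_le_ofReal (Real.exp_pos _).le htail).trans (Real.exp_le_exp.2 ?_)
    rw [div_one, neg_le_neg_iff, show (8 : ℝ) / 2 = 2 ^ 2 by norm_num, Real.log_pow]
    have hVV : 4 / 3 * Real.pi * r ^ 3 ≤ volume.real Ap := by
      rw [hVp]
      gcongr
      linarith
    have hΛle : Λ ≤ ((N : ℝ) + 1) * volume.real Ap := mul_le_mul_of_nonneg_left hVV (by positivity)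
    have hcoef : Real.log 2 / 8 ≤ 8 * ((2 : ℕ) * Real.log 2) - 8 + 2 := by push_cast; linarith
    calc Real.log 2 / 8 * Λ ≤ Real.log 2 / 8 * (((N : ℝ) + 1) * volume.real Ap) :=
          mul_le_mul_of_nonneg_left hΛle (by positivity)
      _ ≤ (8 * ((2 : ℕ) * Real.log 2) - 8 + 2) * (((N : ℝ) + 1) * volume.real Ap) :=
          mul_le_mul_of_nonneg_right hcoef (mul_nonneg (by positivity) measureReal_nonneg)
      _ = ((N : ℝ) + 1) * volume.real Ap * (8 * ((2 : ℕ) * Real.log 2) - 8 + 2) := by ring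
  -- the layer probabilities
  obtain ⟨p, hp⟩ : ∃ p : ℕ → ℝ, ∀ j : ℕ,
      p j = P.real {x | (∑ i, A.indicator (fun _ => (1 : ℝ)) (x i)) = (j : ℝ)} := ⟨_, fun _ => rfl⟩
  obtain ⟨q, hq⟩ : ∃ q : ℕ → ℝ, ∀ j : ℕ,
      q j = P.real {x | (∑ i, A.indicator (fun _ => (1 : ℝ)) (x i)) = (j : ℝ) ∧
        (∑ i, Ap.indicator (fun _ => (1 : ℝ)) (x i)) ≤ M} := ⟨_, fun _ => rfl⟩
  have hp1 : ∀ j, p j ≤ 1 := fun j => by rw [hp]; exact measureReal_le_one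
  have hq0 : ∀ j, 0 ≤ q j := fun j => by rw [hq]; exact measureReal_nonneg
  have hpq : ∀ j, p j ≤ q j + e := fun j => by
    rw [hp, hq, he]
    exact floorTail_layer_split P A Ap M _
  -- the layer inequality and the excluded volume
  obtain ⟨a, ha⟩ : ∃ a : ℝ,
      a = volume.real A - M * volume.real {y : T3 | Torus.euclidDist y c < hsDiameter σ N} := ⟨_, rfl⟩
  have hKI' : ∀ j : ℕ, a * (((N : ℝ) + 1) - j) * q j ≤ ((j : ℝ) + 1) * p (j + 1) := by
    intro j
    rw [ha, hq, hp, Nat.cast_succ]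
    exact hKI N c r M hM0 j
  have ha34 : 3 / 4 * (4 / 3 * Real.pi * r ^ 3) ≤ a := by
    have hMv : M * volume.real {y : T3 | Torus.euclidDist y c < hsDiameter σ N} =
        8 * (4 / 3 * Real.pi * (r + hsDiameter σ N) ^ 3) * (4 / 3 * Real.pi * σ ^ 3) := by
      rw [hM, hVp, hv, ← hnε]
      ring
    have hsmall := floorTail_excluded_small hε h2ε hσ hσ10
    rw [ha, hMv, hV]
    linarith
  -- the layer step, the small layers, the sum
  have hstep : ∀ j : ℕ, (j : ℝ) + 1 ≤ 3 * Λ / 16 → p j ≤ p (j + 1) / 2 + e := fun j hj =>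
    floorTail_layer_step hq0 hpq hKI' (by positivity) hV1 (by positivity) ha34 j (by rw [hΛ] at hj; exact hj)
  have hsmallj : ∀ j : ℕ, (j : ℝ) ≤ Λ / 16 → p j ≤ 4 * Real.exp (-(Real.log 2 / 8 * Λ)) :=
    fun j hj => floorTail_layer_small he0 hp1 hstep heΛ (by linarith) hj
  refine (ENNReal.le_ofReal_iff_toReal_le (measure_ne_top _ _) (by positivity)).2 ?_
  rw [← measureReal_def]
  calc P.real {x | (∑ i, A.indicator (fun _ => (1 : ℝ)) (x i)) ≤ Λ / 16}
      ≤ ∑ j ∈ Finset.range (⌊Λ / 16⌋₊ + 1),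
          P.real {x | (∑ i, A.indicator (fun _ => (1 : ℝ)) (x i)) = (j : ℝ)} :=
        floorTail_sum_layers P A (Λ / 16)
    _ ≤ ∑ j ∈ Finset.range (⌊Λ / 16⌋₊ + 1), 4 * Real.exp (-(Real.log 2 / 8 * Λ)) := by
        refine Finset.sum_le_sum fun j hj => ?_
        rw [← hp]
        refine hsmallj j ?_
        have hj' : j ≤ ⌊Λ / 16⌋₊ := Nat.lt_succ_iff.1 (Finset.mem_range.1 hj)
        exact (Nat.cast_le.2 hj').trans (Nat.floor_le (by positivity))
    _ = ((⌊Λ / 16⌋₊ : ℝ) + 1) * (4 * Real.exp (-(Real.log 2 / 8 * Λ))) := by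
        rw [Finset.sum_const, Finset.card_range, nsmul_eq_mul, Nat.cast_succ]
    _ ≤ 8 * Real.exp (-(Real.log 2 / 16 * Λ)) := floorTail_final_numeric hΛ0

/-- **Floor statics — the lower-tail occupation bound `H-low`** for the canonical hard-sphere gas at small
reduced density (`SmallDensity uniformProfile σ`, `σ ≤ 1/10`): for `P = posGibbsMeasure 1 ε_N (N+1)` and every
ball `A = B(c, r)` with `2ε_N ≤ r < 1/4`, `P{#A ≤ λ/16} ≤ 8 exp(−(log 2/16) λ)`, `λ = (N+1)·(4/3)πr³`
(`posGibbs_ballCount_le_le_of_layer` with the layer inequality `floorStat_layer_ineq`). -/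
theorem posGibbs_ballCount_le_le {σ : ℝ} (hS : SmallDensity uniformProfile σ) (hσ10 : σ ≤ 1 / 10) (N : ℕ)
    (c : T3) (r : ℝ) (h2ε : 2 * hsDiameter σ N ≤ r) (hr : r < 1 / 4) :
    posGibbsMeasure (fun _ => (1 : ℝ)) (hsDiameter σ N) (N + 1)
        {x | (∑ i, ({y : T3 | Torus.euclidDist y c < r}).indicator (fun _ => (1 : ℝ)) (x i)) ≤
            ((N : ℝ) + 1) * (4 / 3 * Real.pi * r ^ 3) / 16} ≤
      ENNReal.ofReal (8 * Real.exp (-(Real.log 2 / 16 * (((N : ℝ) + 1) * (4 / 3 * Real.pi * r ^ 3))))) :=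
  posGibbs_ballCount_le_le_of_layer hS hσ10
    (fun N c r M hM j => floorStat_layer_ineq hS.σ_pos hS.σ_lt_half N c r M hM j) N c r h2ε hr

/-- **Floor statics, quantifier form** — the interface `H-low` of the lead's wave (registered sub-goal
`floor_statics_hLow` of `stub_floorFixed`'s equilibrium rung, consumed by `floorFixed_homogeneous_of_static` as
its hypothesis `hstat`): for every `σ` with `SmallDensity uniformProfile σ` and `σ ≤ 1/10`, every `N`, centre `c`
and radius `2ε_N ≤ r < 1/4`, the bound `posGibbs_ballCount_le_le`. -/
theorem floor_statics_hLow :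
    ∀ (σ : ℝ), SmallDensity uniformProfile σ → σ ≤ 1 / 10 → ∀ (N : ℕ) (c : T3) (r : ℝ),
      2 * hsDiameter σ N ≤ r → r < 1 / 4 →
        posGibbsMeasure (fun _ => (1 : ℝ)) (hsDiameter σ N) (N + 1)
            {x | (∑ i, ({y : T3 | Torus.euclidDist y c < r}).indicator (fun _ => (1 : ℝ)) (x i)) ≤
                ((N : ℝ) + 1) * (4 / 3 * Real.pi * r ^ 3) / 16} ≤
          ENNReal.ofReal (8 * Real.exp (-(Real.log 2 / 16 * (((N : ℝ) + 1) * (4 / 3 * Real.pi * r ^ 3))))) :=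
  fun _ hS hσ10 N c r h2ε hr => posGibbs_ballCount_le_le hS hσ10 N c r h2ε hr

end Summit.AtomisticToContinuum.HydrodynamicLimit.Theorems.AdiabatCeiling

end
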